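import Literature.AnabelianGeometry.SemiGraphs.TemperedInductionOrbit
import Literature.AnabelianGeometry.SemiGraphs.QuasiTemperoids
import HarnessLib

/-!
# Semi-graphs of anabelioids, Appendix: Theorem A.4 — chart-route vocabulary over `T[A] ⊆ B^temp(Π)`

Mochizuki, *Semi-graphs of anabelioids*, Publ. RIMS **42** (2006), Appendix, Theorem A.4 (manuscript
pp. 82–86) [cite: MochizukiSemiAnbd2006, Thm A.4 pp.82-86].  For the kernel proof of the EXISTENCE half
of Thm. A.4 in the Galois-countable case along the chart `T ≌ B^temp(Π)`, `T[A] = Over' A` (the port of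
the tree's Proposition 3.2 engine `TemperoidsHomTorsor/HomHom/HomEqResProofs`, abc-iut-L3-d2, to functors
defined only on `T[A]`), this small DEFINITIONS file packages the test objects of that engine as objects
and arrows of `T[A]`: the Galois objects `Π/N` OVER `A` (through the orbit map of a base point `a ∈ A`,
which requires `N ≤ Stab(a)`), right multiplications, projections and orbit maps — each the tree's
`BTemp.Q / BTemp.rightMul / BTemp.proj / BTemp.orbitMap` (TemperoidsResProofs) lifted by
`ObjectProperty.homMk`, with `rfl` lemmas, plus the cofinality of such `N` (tempered groups have a basis
of open normal subgroups; `Stab(a)` is open).  No statement of the paper is asserted here; nothing takes a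
side on [IUTchIII] Cor. 3.12.
-/

namespace Literature.AnabelianGeometry.SemiGraphs

namespace ThmA4Chart

open CategoryTheory Topology

universe u

variable {G : Type u} [Group G] [TopologicalSpace G] [IsTopologicalGroup G] (hG : IsTempered G)
  (A : BTemp G) (a : A.obj.V)

/-- The Galois object `Π/N` as an object of `T[A] = Over' A`, structured by the orbit map `gN ↦ g · a`
of the base point `a ∈ A` (defined when `N ≤ Stab(a)`). [cite: MochizukiSemiAnbd2006, Thm A.4 pp.82-86] -/
def Q (N : OpenNormalSubgroup G) (hN : N.toSubgroup ≤ BTemp.stab A a) : Over' A :=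
  ⟨BTemp.Q hG N, ⟨BTemp.orbitMap hG A a N hN⟩⟩

/-- Underlying object of `Q`. [cite: MochizukiSemiAnbd2006, Thm A.4 pp.82-86] -/
@[simp] theorem Q_obj (N : OpenNormalSubgroup G) (hN : N.toSubgroup ≤ BTemp.stab A a) :
    (Q hG A a N hN).obj = BTemp.Q hG N := rfl

/-- Right multiplication `r_g : Π/N → Π/N`, as an arrow of `T[A]`. [cite: MochizukiSemiAnbd2006, Thm A.4 pp.82-86] -/
def rightMul (N : OpenNormalSubgroup G) (hN : N.toSubgroup ≤ BTemp.stab A a) (g : G) :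
    Q hG A a N hN ⟶ Q hG A a N hN :=
  ObjectProperty.homMk (BTemp.rightMul hG N g)

/-- Underlying arrow of `rightMul`. [cite: MochizukiSemiAnbd2006, Thm A.4 pp.82-86] -/
@[simp] theorem rightMul_hom (N : OpenNormalSubgroup G) (hN : N.toSubgroup ≤ BTemp.stab A a) (g : G) :
    (rightMul hG A a N hN g).hom = BTemp.rightMul hG N g := rfl

/-- The projection `Π/N → Π/M` (`N ≤ M`), as an arrow of `T[A]`. [cite: MochizukiSemiAnbd2006, Thm A.4 pp.82-86] -/
def proj {N M : OpenNormalSubgroup G} (hN : N.toSubgroup ≤ BTemp.stab A a)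
    (hM : M.toSubgroup ≤ BTemp.stab A a) (h : N ≤ M) : Q hG A a N hN ⟶ Q hG A a M hM :=
  ObjectProperty.homMk (BTemp.proj hG h)

/-- Underlying arrow of `proj`. [cite: MochizukiSemiAnbd2006, Thm A.4 pp.82-86] -/
@[simp] theorem proj_hom {N M : OpenNormalSubgroup G} (hN : N.toSubgroup ≤ BTemp.stab A a)
    (hM : M.toSubgroup ≤ BTemp.stab A a) (h : N ≤ M) :
    (proj hG A a hN hM h).hom = BTemp.proj hG h := rfl

/-- The orbit map `Π/N → X`, `gN ↦ g · x`, for `X ∈ T[A]` and `N ≤ Stab(x)`, as an arrow of `T[A]`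
(any arrow of `B^temp(Π)` between objects of the full subcategory `T[A]`).
[cite: MochizukiSemiAnbd2006, Thm A.4 pp.82-86] -/
def orbitMap (X : Over' A) (x : X.obj.obj.V) (N : OpenNormalSubgroup G)
    (hN : N.toSubgroup ≤ BTemp.stab A a) (hNx : N.toSubgroup ≤ BTemp.stab X.obj x) :
    Q hG A a N hN ⟶ X :=
  ObjectProperty.homMk (BTemp.orbitMap hG X.obj x N hNx)

/-- Underlying arrow of `orbitMap`. [cite: MochizukiSemiAnbd2006, Thm A.4 pp.82-86] -/
@[simp] theorem orbitMap_hom (X : Over' A) (x : X.obj.obj.V) (N : OpenNormalSubgroup G)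
    (hN : N.toSubgroup ≤ BTemp.stab A a) (hNx : N.toSubgroup ≤ BTemp.stab X.obj x) :
    (orbitMap hG A a X x N hN hNx).hom = BTemp.orbitMap hG X.obj x N hNx := rfl

include hG in
omit [IsTopologicalGroup G] in
/-- **Cofinality.** The open normal subgroups `N ≤ Stab(a)` are cofinal among all open normal subgroups
of the tempered group `Π` (so the Galois objects `Π/N` over `A` form a cofinal system of test objects):
`Stab(a)` is open and open normal subgroups form a basis of neighbourhoods of `1` (Def. 3.1 (i)).
[cite: MochizukiSemiAnbd2006, Rmk 3.1.2 p.33] -/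
theorem exists_le_stab (M : OpenNormalSubgroup G) :
    ∃ N : OpenNormalSubgroup G, N ≤ M ∧ N.toSubgroup ≤ BTemp.stab A a := by
  have hmem : ((M : Set G) ∩ (BTemp.stab A a : Set G)) ∈ 𝓝 (1 : G) :=
    Filter.inter_mem (M.toOpenSubgroup.mem_nhds_one)
      ((BTemp.isOpen_stab A a).mem_nhds (BTemp.stab A a).one_mem)
  obtain ⟨N, -, hN⟩ := hG.basis _ hmem
  refine ⟨N, fun g hg => ?_, fun g hg => ?_⟩
  · exact (hN hg).1
  · exact (hN hg).2

omit [IsTopologicalGroup G] in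
/-- The base object `A` over itself. [cite: MochizukiSemiAnbd2006, Def A.1(i) p.79] -/
def base : Over' A := ⟨A, ⟨𝟙 A⟩⟩

omit [IsTopologicalGroup G] in
/-- Underlying object of `base`. [cite: MochizukiSemiAnbd2006, Def A.1(i) p.79] -/
@[simp] theorem base_obj : (base A).obj = A := rfl

end ThmA4Chart

end Literature.AnabelianGeometry.SemiGraphs
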